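import Literature.NumberTheory.EllipticCurves.PadicSeriesEvaluation
import Literature.NumberTheory.EllipticCurves.PadicSigma
import HarnessLib

/-!
# The formal group of a Weierstrass curve: the fixed point `w(z)`, base change, and the
# `p`-adic dictionary `E₁(ℚ_p) → Ê(pℤ_p)` (proofs only)

Trunk T-NT-EC (Literature/NumberTheory/EllipticCurves); second file of the theta-leaf layer
behind `WeierstrassCurve.padicSigma_theta` / `WeierstrassCurve.exists_isCanonical`. No new
definitions. For the objects of `FormalGroup.lean` (`formalWStep`, `formalW`, `formalWDivCube`,
`formalXMulSq`) and `PadicSigma.lean` (`formalNeg`) we prove: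

* `formalWStep_formalW` — **AEC IV.1.1(a)**: `w(z)` IS a fixed point, `w = f(z, w)`
  (`f(w) - f(w') = (w - w')·(…)` with the bracket in `(z)`, so the iterates `fᵏ(0)` stabilise
  coefficientwise, `X_pow_dvd_iterate_succ_sub`);
* `map_formalW`, `map_formalWDivCube`, `map_formalXMulSq`, `map_formalNeg` — the expansions
  commute with ring homomorphisms (they have coefficients in `ℤ[a₁, …, a₆]`, AEC IV.1), hence
  are `p`-adically INTEGRAL for a `p`-integral equation (`isPadicInt_formalW`, …);
* the dictionary at points (**AEC IV.1 p. 116 / VII.2.2**: "the map `𝓜 → E(K)`,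
  `z ↦ (x(z), y(z))` … has inverse `(x, y) ↦ -x/y`"): for `W/ℚ_p` with `p`-integral
  coefficients and `P = (x, y) ∈ E(ℚ_p)` with `‖x‖ > 1`, putting `z = -x/y`:
  `‖y‖² = ‖x‖³` (`norm_sq_eq_norm_cube`), `‖z‖ < 1`,
  `w(z) = -1/y` (`padicEval_formalW_eq`, by the contraction argument of AEC IV.1.1(b) in
  `pℤ_p`), `z²x(z)|_{z(P)} = x·z(P)²` (`padicEval_formalXMulSq_eq`) and
  `i(z(P)) = z(-P)` (`padicEval_formalNeg_eq`).

## Sources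

* J. H. Silverman, *The Arithmetic of Elliptic Curves*, 2nd ed. (2009), IV.1.1 and its proof
  (pp. 115–116), IV.1 (expansions of `x(z)`, `y(z)`, `i(z)`, pp. 116–118), VII.2.2.

## Design notes

* Evaluation is `Literature.NumberTheory.EllipticCurves.padicEval` (`PadicSeriesEvaluation.lean`);
  integrality of the expansions is obtained from the integral model
  `W.integralModel ℤ_[p]` (Mathlib) and the `map` lemmas, never coefficient by coefficient.
* The fixed-point identity is evaluated on the `ℤ_p`-side through the ring homomorphism
  `evalHom`; the uniqueness `w(z(P)) = -1/y(P)` is the elementary contraction estimate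
  `‖β‖ < 1` in `ℚ_p`.
-/

noncomputable section

open PowerSeries

namespace WeierstrassCurve

variable {R : Type*} [CommRing R] (W : WeierstrassCurve R)

/-! ### AEC IV.1.1(a): `w(z)` is the fixed point of the contraction -/

section FixedPoint

/-- `f(w₁) - f(w₂) = (w₁ - w₂) · β(w₁, w₂)` with
`β = a₁z + a₂z² + a₃(w₁ + w₂) + a₄z(w₁ + w₂) + a₆(w₁² + w₁w₂ + w₂²)`.
[Silverman AEC IV.1.1, proof] [folklore] -/
theorem formalWStep_sub (w₁ w₂ : R⟦X⟧) :
    W.formalWStep w₁ - W.formalWStep w₂ = (w₁ - w₂) * (C W.a₁ * X + C W.a₂ * X ^ 2 +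
      C W.a₃ * (w₁ + w₂) + C W.a₄ * X * (w₁ + w₂) + C W.a₆ * (w₁ ^ 2 + w₁ * w₂ + w₂ ^ 2)) := by
  unfold formalWStep; ring

/-- The bracket `β(w₁, w₂)` lies in `(z)` when `w₁, w₂ ∈ (z)`. [Silverman AEC IV.1.1, proof]
[folklore] -/
theorem X_dvd_formalWStep_bracket {w₁ w₂ : R⟦X⟧} (h₁ : X ∣ w₁) (h₂ : X ∣ w₂) :
    X ∣ C W.a₁ * X + C W.a₂ * X ^ 2 + C W.a₃ * (w₁ + w₂) + C W.a₄ * X * (w₁ + w₂) +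
      C W.a₆ * (w₁ ^ 2 + w₁ * w₂ + w₂ ^ 2) := by
  obtain ⟨u₁, rfl⟩ := h₁
  obtain ⟨u₂, rfl⟩ := h₂
  exact ⟨C W.a₁ + C W.a₂ * X + C W.a₃ * (u₁ + u₂) + C W.a₄ * X * (u₁ + u₂) +
    C W.a₆ * X * (u₁ ^ 2 + u₁ * u₂ + u₂ ^ 2), by ring⟩

/-- The contraction gains one order of vanishing: `zᵐ ∣ w₁ - w₂ ⇒ z^{m+1} ∣ f(w₁) - f(w₂)` for
`w₁, w₂ ∈ (z)`. [Silverman AEC IV.1.1, proof (`|F(α) - F(β)| ≤ |α - β|·…`)] [folklore] -/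
theorem X_pow_dvd_formalWStep_sub {w₁ w₂ : R⟦X⟧} {m : ℕ} (h : X ^ m ∣ w₁ - w₂) (h₁ : X ∣ w₁)
    (h₂ : X ∣ w₂) : X ^ (m + 1) ∣ W.formalWStep w₁ - W.formalWStep w₂ := by
  rw [formalWStep_sub, pow_succ]
  exact mul_dvd_mul h (W.X_dvd_formalWStep_bracket h₁ h₂)

/-- Every iterate `fᵏ(0)` lies in `(z)`. [Silverman AEC IV.1.1(a)] [folklore] -/
theorem X_dvd_iterate_formalWStep (k : ℕ) : X ∣ (W.formalWStep)^[k] 0 :=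
  dvd_trans (dvd_pow_self X three_ne_zero) (W.X_pow_three_dvd_iterate_formalWStep k)

/-- **Successive iterates agree to increasing order**: `z^{k+3} ∣ f^{k+1}(0) - fᵏ(0)`.
[Silverman AEC IV.1.1(a), proof ("the `k`-th iterate agrees with `w` modulo `z^{k+3}`…")]
[folklore] -/
theorem X_pow_dvd_iterate_succ_sub (k : ℕ) :
    X ^ (k + 3) ∣ (W.formalWStep)^[k + 1] 0 - (W.formalWStep)^[k] 0 := by
  induction k with
  | zero =>
    simp only [zero_add, Function.iterate_one, Function.iterate_zero, id_eq, sub_zero]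
    exact ⟨1, by unfold formalWStep; ring⟩
  | succ k ih =>
    have h := W.X_pow_dvd_formalWStep_sub ih (W.X_dvd_iterate_formalWStep (k + 1))
      (W.X_dvd_iterate_formalWStep k)
    rw [← Function.iterate_succ_apply' W.formalWStep (k + 1),
      ← Function.iterate_succ_apply' W.formalWStep k] at h
    rw [show k + 1 + 3 = k + 3 + 1 by ring]
    exact h

/-- The `n`-th coefficient of `fᵏ(0)` is that of `w(z)` as soon as `k ≥ n`.
[Silverman AEC IV.1.1(a)] [folklore] -/
theorem coeff_iterate_formalWStep_of_le {n k : ℕ} (h : n ≤ k) :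
    coeff n ((W.formalWStep)^[k] 0) = coeff n W.formalW := by
  rw [formalW, coeff_mk]
  induction k, h using Nat.le_induction with
  | base => rfl
  | succ k hk ih =>
    rw [← ih]
    have := (X_pow_dvd_iff.mp (W.X_pow_dvd_iterate_succ_sub k)) n (by omega)
    rwa [map_sub, sub_eq_zero] at this

/-- `w(z) ∈ (z)`. [Silverman AEC IV.1.1(a)] [folklore] -/
theorem X_dvd_formalW : X ∣ W.formalW := by
  rw [X_dvd_iff]; exact W.constantCoeff_formalW

/-- **AEC IV.1.1(a): `w(z)` is a fixed point**, `w(z) = f(z, w(z))` with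
`f(z, w) = z³ + a₁zw + a₂z²w + a₃w² + a₄zw² + a₆w³`. [Silverman AEC IV.1.1(a)]
[cite: SilvermanAEC2009, IV.1.1] -/
theorem formalWStep_formalW : W.formalWStep W.formalW = W.formalW := by
  ext n
  have h1 : X ^ (n + 1) ∣ W.formalW - (W.formalWStep)^[n + 1] 0 := by
    rw [X_pow_dvd_iff]
    intro m hm
    rw [map_sub, W.coeff_iterate_formalWStep_of_le (by omega : m ≤ n + 1), sub_self]
  have h2 := W.X_pow_dvd_formalWStep_sub h1 W.X_dvd_formalW (W.X_dvd_iterate_formalWStep (n + 1))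
  have h3 := (X_pow_dvd_iff.mp h2) n (by omega)
  rw [map_sub, sub_eq_zero, ← Function.iterate_succ_apply' W.formalWStep (n + 1)] at h3
  rw [h3, W.coeff_iterate_formalWStep_of_le (by omega : n ≤ n + 1 + 1)]

/-- `w(z) = z³ · B(z)` with `B = formalWDivCube`. [Silverman AEC IV.1.1(a)] [folklore] -/
theorem formalW_eq_X_pow_mul_formalWDivCube : W.formalW = X ^ 3 * W.formalWDivCube := by
  ext n
  rw [coeff_X_pow_mul']
  split_ifs with h
  · rw [formalWDivCube, coeff_mk, Nat.sub_add_cancel h]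
  · exact W.coeff_formalW_of_lt_three (by omega)

end FixedPoint

/-! ### The expansions commute with ring homomorphisms (coefficients in `ℤ[a₁, …, a₆]`) -/

section Map

variable {S : Type*} [CommRing S] (φ : R →+* S)

/-- `f` commutes with `map`. [Silverman AEC IV.1 ("coefficients in `ℤ[a₁, …, a₆]`")] [folklore] -/
theorem map_formalWStep (w : R⟦X⟧) :
    PowerSeries.map φ (W.formalWStep w) = (W.map φ).formalWStep (PowerSeries.map φ w) := by
  simp only [formalWStep, map_add, map_mul, map_pow, PowerSeries.map_C, PowerSeries.map_X, map_a₁,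
    map_a₂, map_a₃, map_a₄, map_a₆]

/-- The iterates commute with `map`. [folklore] -/
theorem map_iterate_formalWStep (k : ℕ) :
    PowerSeries.map φ ((W.formalWStep)^[k] 0) = ((W.map φ).formalWStep)^[k] 0 := by
  induction k with
  | zero => simp
  | succ k ih => rw [Function.iterate_succ_apply', Function.iterate_succ_apply', map_formalWStep, ih]

/-- **`w(z)` has coefficients in `ℤ[a₁, …, a₆]`**, in the form: `w` commutes with base change.
[Silverman AEC IV.1.1(a) (`Aₙ ∈ ℤ[a₁, …, a₆]`)] [cite: SilvermanAEC2009, IV.1.1] -/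
theorem map_formalW : PowerSeries.map φ W.formalW = (W.map φ).formalW := by
  ext n
  rw [coeff_map, formalW, formalW, coeff_mk, coeff_mk, ← coeff_map, map_iterate_formalWStep]

/-- `B = w/z³` commutes with base change. [folklore] -/
theorem map_formalWDivCube : PowerSeries.map φ W.formalWDivCube = (W.map φ).formalWDivCube := by
  ext n
  rw [coeff_map, formalWDivCube, formalWDivCube, coeff_mk, coeff_mk, ← coeff_map, map_formalW]

/-- `map` commutes with inverting a series of constant term `1`. [folklore] -/
theorem _root_.Literature.NumberTheory.EllipticCurves.map_invOfUnit_one (g : R⟦X⟧)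
    (hg : constantCoeff g = 1) :
    PowerSeries.map φ (invOfUnit g 1) = invOfUnit (PowerSeries.map φ g) 1 := by
  have h1 : g * invOfUnit g 1 = 1 := mul_invOfUnit g 1 (by rw [hg, Units.val_one])
  have hg' : constantCoeff (PowerSeries.map φ g) = 1 := by
    rw [← coeff_zero_eq_constantCoeff_apply, coeff_map, coeff_zero_eq_constantCoeff_apply, hg,
      map_one]
  have h2 : PowerSeries.map φ g * invOfUnit (PowerSeries.map φ g) 1 = 1 :=
    mul_invOfUnit _ 1 (by rw [hg', Units.val_one])
  have h1' : PowerSeries.map φ (invOfUnit g 1) * PowerSeries.map φ g = 1 := by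
    rw [mul_comm, ← map_mul, h1, map_one]
  exact left_inv_eq_right_inv h1' h2

/-- **`z²x(z)` commutes with base change** (coefficients in `ℤ[a₁, …, a₆]`).
[Silverman AEC IV.1 (p. 116)] [cite: SilvermanAEC2009, IV.1.1] -/
theorem map_formalXMulSq : PowerSeries.map φ W.formalXMulSq = (W.map φ).formalXMulSq := by
  rw [formalXMulSq, formalXMulSq,
    Literature.NumberTheory.EllipticCurves.map_invOfUnit_one φ _ W.constantCoeff_formalWDivCube,
    map_formalWDivCube]

/-- **`i(z)` commutes with base change** (`i ∈ ℤ[a₁, …, a₆]⟦z⟧`). [Silverman AEC IV.1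
(p. 117, `i(z) ∈ ℤ[a₁, …, a₆]⟦z⟧`)] [cite: SilvermanAEC2009, IV.1.1] -/
theorem map_formalNeg : PowerSeries.map φ W.formalNeg = (W.map φ).formalNeg := by
  have hg : constantCoeff (1 - C W.a₁ * X - C W.a₃ * W.formalW) = 1 := by
    simp [W.constantCoeff_formalW]
  rw [formalNeg, formalNeg, map_neg, map_mul, PowerSeries.map_X,
    Literature.NumberTheory.EllipticCurves.map_invOfUnit_one φ _ hg]
  simp only [map_sub, map_one, map_mul, PowerSeries.map_C, PowerSeries.map_X, map_formalW, map_a₁,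
    map_a₃]

end Map

/-! ### Over `ℚ_p`: integrality of the expansions for a `p`-integral equation -/

section Padic

open Literature.NumberTheory.EllipticCurves

variable {p : ℕ} [Fact p.Prime] (W : WeierstrassCurve ℚ_[p]) [hW : W.IsIntegral ℤ_[p]]

/-- The algebra map `ℤ_p → ℚ_p` is the inclusion. [folklore] -/
theorem _root_.Literature.NumberTheory.EllipticCurves.algebraMap_padicInt_eq :
    algebraMap ℤ_[p] ℚ_[p] = PadicInt.Coe.ringHom :=
  RingHom.ext fun _ => rfl

/-- Constants of norm `≤ 1` are integral (one-variable `PowerSeries.C` form of `IsPadicInt.C`).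
[folklore] -/
theorem _root_.Literature.NumberTheory.EllipticCurves.IsPadicInt.powerSeries_C {c : ℚ_[p]}
    (hc : ‖c‖ ≤ 1) : IsPadicInt (PowerSeries.C c : ℚ_[p]⟦X⟧) :=
  IsPadicInt.C hc

/-- A `p`-integral `W/ℚ_p` is the base change of its integral model. [folklore] -/
theorem eq_map_integralModel : (W.integralModel ℤ_[p]).map PadicInt.Coe.ringHom = W := by
  rw [← algebraMap_padicInt_eq]; exact W.baseChange_integralModel_eq (R := ℤ_[p])

omit hW in
/-- Coefficients of a base change from `ℤ_p` have norm `≤ 1`. [folklore] -/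
theorem norm_coeffs_le_one_of_map (V : WeierstrassCurve ℤ_[p])
    (hV : V.map PadicInt.Coe.ringHom = W) :
    ‖W.a₁‖ ≤ 1 ∧ ‖W.a₂‖ ≤ 1 ∧ ‖W.a₃‖ ≤ 1 ∧ ‖W.a₄‖ ≤ 1 ∧ ‖W.a₆‖ ≤ 1 := by
  subst hV
  exact ⟨PadicInt.norm_le_one _, PadicInt.norm_le_one _, PadicInt.norm_le_one _,
    PadicInt.norm_le_one _, PadicInt.norm_le_one _⟩

/-- `‖aᵢ‖ ≤ 1` for a `p`-integral equation. [folklore] -/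
theorem norm_coeffs_le_one :
    ‖W.a₁‖ ≤ 1 ∧ ‖W.a₂‖ ≤ 1 ∧ ‖W.a₃‖ ≤ 1 ∧ ‖W.a₄‖ ≤ 1 ∧ ‖W.a₆‖ ≤ 1 :=
  W.norm_coeffs_le_one_of_map _ W.eq_map_integralModel

/-- `w(z) ∈ ℤ_p⟦z⟧` for a `p`-integral equation. [Silverman AEC IV.1.1(a)] [folklore] -/
theorem isPadicInt_formalW : IsPadicInt W.formalW := by
  rw [isPadicInt_iff_exists_powerSeries_map]
  exact ⟨(W.integralModel ℤ_[p]).formalW, by rw [map_formalW, eq_map_integralModel]⟩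

/-- `w(z)/z³ ∈ ℤ_p⟦z⟧`. [Silverman AEC IV.1.1(a)] [folklore] -/
theorem isPadicInt_formalWDivCube : IsPadicInt W.formalWDivCube := by
  rw [isPadicInt_iff_exists_powerSeries_map]
  exact ⟨(W.integralModel ℤ_[p]).formalWDivCube, by rw [map_formalWDivCube, eq_map_integralModel]⟩

/-- `z²x(z) ∈ ℤ_p⟦z⟧`. [Silverman AEC IV.1 (p. 116)] [folklore] -/
theorem isPadicInt_formalXMulSq : IsPadicInt W.formalXMulSq := by
  rw [isPadicInt_iff_exists_powerSeries_map]
  exact ⟨(W.integralModel ℤ_[p]).formalXMulSq, by rw [map_formalXMulSq, eq_map_integralModel]⟩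

/-- `i(z) ∈ ℤ_p⟦z⟧`. [Silverman AEC IV.1 (p. 117)] [folklore] -/
theorem isPadicInt_formalNeg : IsPadicInt W.formalNeg := by
  rw [isPadicInt_iff_exists_powerSeries_map]
  exact ⟨(W.integralModel ℤ_[p]).formalNeg, by rw [map_formalNeg, eq_map_integralModel]⟩

/-- The denominator `1 - a₁z - a₃w(z)` of `i(z)` is integral. [folklore] -/
theorem isPadicInt_formalNegDenom : IsPadicInt (1 - C W.a₁ * X - C W.a₃ * W.formalW) :=
  (IsPadicInt.one.sub ((IsPadicInt.powerSeries_C W.norm_coeffs_le_one.1).mul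
    IsPadicInt.powerSeries_X)).sub
    ((IsPadicInt.powerSeries_C W.norm_coeffs_le_one.2.2.1).mul W.isPadicInt_formalW)

/-- … and so is its inverse. [folklore] -/
theorem isPadicInt_invOfUnit_formalNegDenom :
    IsPadicInt (invOfUnit (1 - C W.a₁ * X - C W.a₃ * W.formalW) 1) := by
  rw [isPadicInt_iff_exists_powerSeries_map]
  set V := W.integralModel ℤ_[p]
  have hg : constantCoeff (1 - C V.a₁ * X - C V.a₃ * V.formalW) = 1 := by
    simp [V.constantCoeff_formalW]
  refine ⟨invOfUnit (1 - C V.a₁ * X - C V.a₃ * V.formalW) 1, ?_⟩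
  rw [map_invOfUnit_one _ _ hg]
  congr 1
  simp only [map_sub, map_one, map_mul, PowerSeries.map_C, PowerSeries.map_X, map_formalW]
  rw [← W.eq_map_integralModel, map_a₁, map_a₃]

/-! ### Norms on `E₁(ℚ_p)`: `‖y‖² = ‖x‖³` -/

omit hW in
/-- Ultrametric bookkeeping: `‖a‖ < 1`, `‖b‖ < 1 ⇒ ‖a + b‖ < 1`. [folklore] -/
theorem _root_.Literature.NumberTheory.EllipticCurves.padic_norm_add_lt_one {a b : ℚ_[p]}
    (ha : ‖a‖ < 1) (hb : ‖b‖ < 1) : ‖a + b‖ < 1 :=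
  (Padic.nonarchimedean a b).trans_lt (max_lt ha hb)

omit hW in
/-- `‖a‖ ≤ 1`, `‖b‖ < 1 ⇒ ‖a b‖ < 1`. [folklore] -/
theorem _root_.Literature.NumberTheory.EllipticCurves.padic_norm_mul_lt_one {a b : ℚ_[p]}
    (ha : ‖a‖ ≤ 1) (hb : ‖b‖ < 1) : ‖a * b‖ < 1 := by
  rw [norm_mul]; exact mul_lt_one_of_nonneg_of_lt_one_right ha (norm_nonneg _) hb

/-- **`‖y‖² = ‖x‖³` and `‖y‖ > ‖x‖` for `(x, y) ∈ E(ℚ_p)` with `‖x‖ > 1`** on a `p`-integral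
equation (the cubic term dominates the right-hand side, so `y²` must dominate the left).
[Silverman AEC VII.2.2 proof / IV.1 (`x⁻¹ ∈ 𝓜`: `3v(x) = 2v(y)`)] [folklore] -/
theorem norm_sq_eq_norm_cube {x y : ℚ_[p]} (heq : W.toAffine.Equation x y) (hx : 1 < ‖x‖) :
    ‖y‖ ^ 2 = ‖x‖ ^ 3 ∧ ‖x‖ < ‖y‖ := by
  obtain ⟨h₁, h₂, h₃, h₄, h₆⟩ := W.norm_coeffs_le_one
  rw [Affine.equation_iff] at heq
  have hx0 : 0 < ‖x‖ := one_pos.trans hx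
  have hx1 : 1 ≤ ‖x‖ := hx.le
  have hx2 : ‖x‖ ≤ ‖x‖ ^ 2 := by nlinarith
  have hx3 : ‖x‖ ^ 2 < ‖x‖ ^ 3 := by nlinarith
  -- the right-hand side has norm `‖x‖³`
  have hr : ‖W.a₂ * x ^ 2 + W.a₄ * x + W.a₆‖ ≤ ‖x‖ ^ 2 := by
    refine (Padic.nonarchimedean _ _).trans (max_le ((Padic.nonarchimedean _ _).trans
      (max_le ?_ ?_)) (h₆.trans (one_le_pow₀ hx1)))
    · rw [norm_mul, norm_pow]; exact mul_le_of_le_one_left (by positivity) h₂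
    · rw [norm_mul]; exact (mul_le_of_le_one_left (norm_nonneg _) h₄).trans hx2
  have hR : ‖x ^ 3 + W.a₂ * x ^ 2 + W.a₄ * x + W.a₆‖ = ‖x‖ ^ 3 := by
    rw [show x ^ 3 + W.a₂ * x ^ 2 + W.a₄ * x + W.a₆ = x ^ 3 + (W.a₂ * x ^ 2 + W.a₄ * x + W.a₆)
      by ring, Padic.add_eq_max_of_ne, norm_pow, max_eq_left (hr.trans hx3.le)]
    rw [norm_pow]; exact (ne_of_lt (hr.trans_lt hx3)).symm
  have hy : ‖x‖ < ‖y‖ := by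
    by_contra hle
    push Not at hle
    have hL : ‖y ^ 2 + W.a₁ * x * y + W.a₃ * y‖ ≤ ‖x‖ ^ 2 := by
      refine (Padic.nonarchimedean _ _).trans (max_le ((Padic.nonarchimedean _ _).trans
        (max_le ?_ ?_)) ?_)
      · rw [norm_pow]; exact pow_le_pow_left₀ (norm_nonneg _) hle 2
      · rw [norm_mul, norm_mul, sq]
        exact mul_le_mul (mul_le_of_le_one_left (norm_nonneg _) h₁) hle (norm_nonneg _)
          (norm_nonneg _)
      · rw [norm_mul]
        exact ((mul_le_of_le_one_left (norm_nonneg _) h₃).trans hle).trans hx2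
    rw [heq, hR] at hL
    exact absurd hL (not_le.mpr hx3)
  have hy0 : 0 < ‖y‖ := hx0.trans hy
  have hl : ‖W.a₁ * x * y + W.a₃ * y‖ < ‖y‖ ^ 2 := by
    refine (Padic.nonarchimedean _ _).trans_lt (max_lt ?_ ?_)
    · rw [norm_mul, norm_mul, sq]
      exact mul_lt_mul_of_pos_right ((mul_le_of_le_one_left (norm_nonneg _) h₁).trans_lt hy) hy0
    · rw [norm_mul, sq]
      exact mul_lt_mul_of_pos_right (h₃.trans_lt (hx.trans hy)) hy0
  have hL : ‖y ^ 2 + W.a₁ * x * y + W.a₃ * y‖ = ‖y‖ ^ 2 := by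
    rw [add_assoc, Padic.add_eq_max_of_ne, norm_pow, max_eq_left hl.le]
    rw [norm_pow]; exact (ne_of_lt hl).symm
  exact ⟨by rw [← hL, heq, hR], hy⟩

/-- Consequences for the parameter: `y ≠ 0`, `z = -x/y ≠ 0`, `‖z‖ < 1`, `‖1/y‖ < 1`, and
`y + a₁x + a₃ ≠ 0` (so `-P` is again an affine point with the same `x`).
[Silverman AEC VII.2.2, IV.1] [folklore] -/
theorem param_facts {x y : ℚ_[p]} (heq : W.toAffine.Equation x y) (hx : 1 < ‖x‖) :
    y ≠ 0 ∧ -x / y ≠ 0 ∧ ‖-x / y‖ < 1 ∧ ‖-1 / y‖ < 1 ∧ y + W.a₁ * x + W.a₃ ≠ 0 := by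
  obtain ⟨h₁, -, h₃, -, -⟩ := W.norm_coeffs_le_one
  obtain ⟨hsq, hxy⟩ := W.norm_sq_eq_norm_cube heq hx
  have hx0 : 0 < ‖x‖ := one_pos.trans hx
  have hy1 : 1 < ‖y‖ := hx.trans hxy
  have hy0 : y ≠ 0 := fun h => by rw [h, norm_zero] at hy1; exact not_lt.mpr zero_le_one hy1
  have hxne : x ≠ 0 := fun h => by rw [h, norm_zero] at hx0; exact lt_irrefl _ hx0
  refine ⟨hy0, div_ne_zero (neg_ne_zero.mpr hxne) hy0, ?_, ?_, ?_⟩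
  · rw [norm_div, norm_neg, div_lt_one (hx0.trans hxy)]; exact hxy
  · rw [norm_div, norm_neg, norm_one, div_lt_one (one_pos.trans hy1)]; exact hy1
  · intro h0
    have : ‖y‖ = ‖W.a₁ * x + W.a₃‖ := by
      rw [show y = -(W.a₁ * x + W.a₃) by linear_combination h0, norm_neg]
    have hlt : ‖W.a₁ * x + W.a₃‖ < ‖y‖ :=
      (Padic.nonarchimedean _ _).trans_lt (max_lt (by
        rw [norm_mul]; exact (mul_le_of_le_one_left (norm_nonneg _) h₁).trans_lt hxy)
        (h₃.trans_lt hy1))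
    rw [← this] at hlt
    exact lt_irrefl _ hlt

/-! ### The dictionary `E₁(ℚ_p) → Ê(pℤ_p)`: `w(z(P)) = -1/y(P)` -/

omit hW in
/-- The fixed-point identity evaluated on the `ℤ_p`-side. [Silverman AEC IV.1.1] [folklore] -/
theorem evalHom_formalW_fixed (V : WeierstrassCurve ℤ_[p]) (t : ℤ_[p]) (ht : ‖t‖ < 1) :
    evalHom t ht V.formalW = t ^ 3 + V.a₁ * t * evalHom t ht V.formalW +
      V.a₂ * t ^ 2 * evalHom t ht V.formalW + V.a₃ * evalHom t ht V.formalW ^ 2 +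
      V.a₄ * t * evalHom t ht V.formalW ^ 2 + V.a₆ * evalHom t ht V.formalW ^ 3 := by
  have hX : evalHom t ht X = t := by rw [evalHom_apply, PowerSeries.eval₂_X]
  have hC : ∀ a : ℤ_[p], evalHom t ht (C a) = a := fun a => by
    rw [evalHom_apply, PowerSeries.eval₂_C, RingHom.id_apply]
  conv_lhs => rw [← V.formalWStep_formalW, formalWStep]
  simp only [map_add, map_mul, map_pow, hX, hC]

/-- **AEC VII.2.2 / IV.1.1(b) at a point: `w(z(P)) = -1/y(P)`** for `P = (x, y) ∈ E(ℚ_p)` with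
`‖x‖ > 1` on a `p`-integral equation. Both `w(z(P))` (evaluate the fixed-point identity) and
`w₀ = -1/y` (the Weierstrass equation divided by `y³`) are fixed points of `w ↦ f(z, w)` in the
open unit disc, and `f(z, ·)` is a contraction there: `w₀ - ŵ = (w₀ - ŵ)β` with `‖β‖ < 1`.
[Silverman AEC IV.1.1(b), VII.2.2 ("the map … has inverse `(x, y) ↦ -x/y`")]
[cite: SilvermanAEC2009, VII.2.2] -/
theorem padicEval_formalW_eq {x y : ℚ_[p]} (heq : W.toAffine.Equation x y) (hx : 1 < ‖x‖) :
    padicEval W.formalW (-x / y) = -1 / y := by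
  obtain ⟨h₁, h₂, h₃, h₄, h₆⟩ := W.norm_coeffs_le_one
  obtain ⟨hy0, hz0, hz1, hw1, -⟩ := W.param_facts heq hx
  set z : ℚ_[p] := -x / y with hzdef
  set w₀ : ℚ_[p] := -1 / y with hw₀def
  set ŵ : ℚ_[p] := padicEval W.formalW z with hŵdef
  -- (i) `ŵ` is a fixed point (evaluate AEC IV.1.1(a) through the integral model)
  have hfix : ŵ = z ^ 3 + W.a₁ * z * ŵ + W.a₂ * z ^ 2 * ŵ + W.a₃ * ŵ ^ 2 + W.a₄ * z * ŵ ^ 2 +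
      W.a₆ * ŵ ^ 3 := by
    obtain ⟨z', hz', hz1'⟩ := exists_coe_eq_of_norm_lt_one hz1
    set V := W.integralModel ℤ_[p]
    have hV := W.eq_map_integralModel
    have hŵ : ŵ = (evalHom z' hz1' V.formalW : ℤ_[p]) := by
      rw [hŵdef, ← hz', ← padicEval_map V.formalW hz1', map_formalW, hV]
    have key := congrArg ((↑) : ℤ_[p] → ℚ_[p]) (evalHom_formalW_fixed V z' hz1')
    push_cast at key
    rw [← hŵ, hz'] at key
    have ha₁ : (V.a₁ : ℚ_[p]) = W.a₁ := by rw [← hV, map_a₁]; rfl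
    have ha₂ : (V.a₂ : ℚ_[p]) = W.a₂ := by rw [← hV, map_a₂]; rfl
    have ha₃ : (V.a₃ : ℚ_[p]) = W.a₃ := by rw [← hV, map_a₃]; rfl
    have ha₄ : (V.a₄ : ℚ_[p]) = W.a₄ := by rw [← hV, map_a₄]; rfl
    have ha₆ : (V.a₆ : ℚ_[p]) = W.a₆ := by rw [← hV, map_a₆]; rfl
    rw [ha₁, ha₂, ha₃, ha₄, ha₆] at key
    exact key
  -- (ii) `w₀ = -1/y` is a fixed point (the Weierstrass equation divided by `y³`)
  have hw0 : w₀ = z ^ 3 + W.a₁ * z * w₀ + W.a₂ * z ^ 2 * w₀ + W.a₃ * w₀ ^ 2 + W.a₄ * z * w₀ ^ 2 +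
      W.a₆ * w₀ ^ 3 := by
    rw [Affine.equation_iff] at heq
    rw [hzdef, hw₀def]
    field_simp
    linear_combination (-1 : ℚ_[p]) * heq
  -- (iii) both lie in the open unit disc
  have hŵ1 : ‖ŵ‖ < 1 := norm_padicEval_lt_one W.isPadicInt_formalW W.constantCoeff_formalW hz1
  -- (iv) contraction
  set β : ℚ_[p] := W.a₁ * z + W.a₂ * z ^ 2 + W.a₃ * (w₀ + ŵ) + W.a₄ * z * (w₀ + ŵ) +
    W.a₆ * (w₀ ^ 2 + w₀ * ŵ + ŵ ^ 2) with hβ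
  have hβ1 : ‖β‖ < 1 := by
    have hz1' : ‖z‖ ≤ 1 := hz1.le
    have hs : ‖w₀ + ŵ‖ < 1 := padic_norm_add_lt_one hw1 hŵ1
    refine padic_norm_add_lt_one (padic_norm_add_lt_one (padic_norm_add_lt_one
      (padic_norm_add_lt_one (padic_norm_mul_lt_one h₁ hz1) ?_) (padic_norm_mul_lt_one h₃ hs))
      ?_) ?_
    · exact padic_norm_mul_lt_one h₂ (by rw [norm_pow]; exact pow_lt_one₀ (norm_nonneg _) hz1 two_ne_zero)
    · rw [mul_assoc]; exact padic_norm_mul_lt_one h₄ (padic_norm_mul_lt_one hz1' hs)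
    · refine padic_norm_mul_lt_one h₆ (padic_norm_add_lt_one (padic_norm_add_lt_one ?_ ?_) ?_)
      · rw [norm_pow]; exact pow_lt_one₀ (norm_nonneg _) hw1 two_ne_zero
      · exact padic_norm_mul_lt_one hw1.le hŵ1
      · rw [norm_pow]; exact pow_lt_one₀ (norm_nonneg _) hŵ1 two_ne_zero
  have hprod : (w₀ - ŵ) * (1 - β) = 0 := by
    rw [hβ]; linear_combination hw0 - hfix
  have hne : (1 : ℚ_[p]) - β ≠ 0 := by
    intro h0
    rw [sub_eq_zero] at h0
    rw [← h0, norm_one] at hβ1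
    exact lt_irrefl _ hβ1
  have := (mul_eq_zero.mp hprod).resolve_right hne
  rw [sub_eq_zero] at this
  exact this.symm

/-- **`z² x(z)` at `z(P)` is `x(P) z(P)²`** (`x = z/w`): the Laurent expansion of `x` evaluates
to the `x`-coordinate. [Silverman AEC IV.1 (p. 116, `x(z) = z/w(z)`), VII.2.2]
[cite: SilvermanAEC2009, VII.2.2] -/
theorem padicEval_formalXMulSq_eq {x y : ℚ_[p]} (heq : W.toAffine.Equation x y) (hx : 1 < ‖x‖) :
    padicEval W.formalXMulSq (-x / y) = x * (-x / y) ^ 2 := by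
  obtain ⟨hy0, hz0, hz1, -, -⟩ := W.param_facts heq hx
  have hw := W.padicEval_formalW_eq heq hx
  have hB : padicEval W.formalWDivCube (-x / y) * (-x / y) ^ 3 = -1 / y := by
    rw [← hw, W.formalW_eq_X_pow_mul_formalWDivCube, padicEval_mul (IsPadicInt.powerSeries_X.pow 3)
      W.isPadicInt_formalWDivCube hz1, padicEval_pow IsPadicInt.powerSeries_X hz1, padicEval_X,
      mul_comm]
  rw [padicEval_eq_inv_of_mul_eq_one W.isPadicInt_formalWDivCube W.isPadicInt_formalXMulSq
    W.formalWDivCube_mul_formalXMulSq hz1]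
  have hBv : padicEval W.formalWDivCube (-x / y) = (-1 / y) / (-x / y) ^ 3 := by
    rw [eq_div_iff (pow_ne_zero 3 hz0)]; exact hB
  rw [hBv, inv_div]
  field_simp


/-- **`i(z(P)) = z(-P)`**: the formal inverse evaluates to the parameter of `-P = (x, -y-a₁x-a₃)`.
[Silverman AEC IV.1 (p. 117, "the `w`-coordinate of the inverse … is `w(i(z))`")]
[cite: SilvermanAEC2009, IV.1.1] -/
theorem padicEval_formalNeg_eq {x y : ℚ_[p]} (heq : W.toAffine.Equation x y) (hx : 1 < ‖x‖) :
    padicEval W.formalNeg (-x / y) = -x / W.toAffine.negY x y := by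
  obtain ⟨hy0, hz0, hz1, -, hneg⟩ := W.param_facts heq hx
  have hw := W.padicEval_formalW_eq heq hx
  have hg : constantCoeff (1 - C W.a₁ * X - C W.a₃ * W.formalW) = 1 := by
    simp [W.constantCoeff_formalW]
  have hgi : (1 - C W.a₁ * X - C W.a₃ * W.formalW) * invOfUnit (1 - C W.a₁ * X - C W.a₃ * W.formalW) 1
      = 1 := mul_invOfUnit _ 1 (by rw [hg, Units.val_one])
  have hge : padicEval (1 - C W.a₁ * X - C W.a₃ * W.formalW) (-x / y) =
      1 - W.a₁ * (-x / y) - W.a₃ * (-1 / y) := by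
    have hc₁ := IsPadicInt.powerSeries_C W.norm_coeffs_le_one.1
    have hc₃ := IsPadicInt.powerSeries_C W.norm_coeffs_le_one.2.2.1
    rw [padicEval_sub (IsPadicInt.one.sub (hc₁.mul IsPadicInt.powerSeries_X))
        (hc₃.mul W.isPadicInt_formalW) hz1,
      padicEval_sub IsPadicInt.one (hc₁.mul IsPadicInt.powerSeries_X) hz1,
      padicEval_mul hc₁ IsPadicInt.powerSeries_X hz1, padicEval_mul hc₃ W.isPadicInt_formalW hz1,
      padicEval_one, padicEval_C, padicEval_C, padicEval_X, hw]
  rw [formalNeg, padicEval_neg (IsPadicInt.powerSeries_X.mul W.isPadicInt_invOfUnit_formalNegDenom)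
    hz1, padicEval_mul IsPadicInt.powerSeries_X W.isPadicInt_invOfUnit_formalNegDenom hz1,
    padicEval_X, padicEval_eq_inv_of_mul_eq_one W.isPadicInt_formalNegDenom
    W.isPadicInt_invOfUnit_formalNegDenom hgi hz1, hge, Affine.negY]
  have hden : 1 - W.a₁ * (-x / y) - W.a₃ * (-1 / y) = (y + W.a₁ * x + W.a₃) / y := by
    field_simp; ring
  rw [hden, inv_div, show -y - W.a₁ * x - W.a₃ = -(y + W.a₁ * x + W.a₃) by ring, neg_div_neg_eq]
  field_simp

/-- The tree's `padicFormalLog` is `padicEval` of `formalLog`. [folklore] -/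
theorem padicFormalLog_eq_padicEval (V : WeierstrassCurve ℚ_[p]) (t : ℚ_[p]) :
    V.padicFormalLog t = padicEval V.formalLog t := rfl

end Padic

end WeierstrassCurve
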